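import Summits.Ventures.CertifiedQuantumChemistry.Certificates.HubbardRingL6SingletLiftBlockG0B
import HarnessLib

/-!
# Ventures/CertifiedQuantumChemistry — Certificates/HubbardRingL6SingletLiftBlockG0.lean: the `G_0` block of the EXACT L = 6 DQG+S² (singlet) lift
# (`pub-qchem-rdmb/ab-files/v44/lift2_L6_DQG_s2v0.json`, rdm-B gen 24) is positive semidefinite along the family for `0 < ε ≤ ε₀`
# — a STRUCTURED RATIONAL pencil certificate (`Rows/PencilBlockCertificateRat.lean`), kernel-checked

HONEST FRAMING (verbatim): certified bounds for a stated model Hamiltonian in a stated basis; not a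
claim about the real molecule beyond that model. Auxiliary object (one symmetry block of a polynomial family of relaxation variables of the
half-filled Hubbard 6-ring's singlet-restricted level-DQG programme (DQG + the `⟨Ŝ²⟩ = 0` row)); no model energy is bounded here.

Seat rdm-B (gen 43; the DQG+S² twin of gen 42's `…L6LiftBlockG0.lean` — plan `tools/x14-g42/l6/MEMO-L6-KERNEL-FLOOR.md` §5; data by gen 42's
`tools/x14-g42/l6/pencil6b.py` run UNCHANGED on the s2v0 lift (`tools/x14-g43/l6s/`) + `tools/x14-g43/l6s/mkblock6s.py`, an exact
re-derivation in the LEAN CONVENTION (orbital `2p+σ`, `Q = qMapP`, `G = gMapP`, pair blocks compressed to antisymmetric coordinates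
`uu 15 | mixed 36 | dd 15`, particle–hole blocks `0 72 | ud 36 | du 36`) of the block `G_0` (Lean-side dimension 72 — here on the REDUCED index set `Fin 71` after the facial reduction of its one forced kernel direction, see `…LiftBlockG0Face.lean`) of the lift family
`y(ε) = y₀ + ε y₁ + ε² y₂` (`ε = 1/U`). UNTRUSTED data, consumed only through kernel evaluation: the three coefficient tables `X₀, X₁, X₂`
(integer numerators over ONE denominator of 90 bits), the free-coordinate mask and kernel columns `W` of `X₀` (RREF, identity pattern; 5 free
coordinates), an integer rounded Gram factor `R` (63 bits, scale `2^60`) of the pencil's constant term `L − 2μ·1`, and the scalars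
`μ = 1/10000000000000`, `ρ₁`, `ρ₂`, `c`, `D`. PART B (this file; PART A / A2 = data + kernel facts, PART B1 = symmetry of `A` + Gram rows chunks 1–2): the last Gram row-inequality kernel run, the integer rounded Gram certificate and THE THEOREM **`l6sG0_psd`**: `PencilRat.realXQ l6sG0X ε ⪰ 0` for `0 < ε ≤ 1`, `ε·(ρ₁ + ρ₂) ≤ μ`
(`ε₀ ≈ 6.557e-16`, i.e. `U ≥ 1.525e+15` — irrelevant for the limit statement this serves). 0 sorry; standard axioms.
-/

set_option linter.style.longLine false

namespace Summit.Ventures.CertifiedQuantumChemistry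

namespace LiftL6

open Matrix Finset PencilRat Literature.Computation.Certificates.PSD

/-! ## §2c The last Gram rows and the block theorem -/

set_option maxHeartbeats 4000000 in
/-- Diagonal dominance of the Gram residual, rows `47 ≤ i < 71`. -/
theorem l6sG0_grows2 : ∀ i : Fin 71, 47 ≤ (i : ℕ) → (i : ℕ) < 71 →
    ∑ j ∈ Finset.univ.erase i, |gramResidualZ l6sG0A l6sG0dg l6sG0R i j| ≤ gramResidualZ l6sG0A l6sG0dg l6sG0R i i := by
  decide +kernel

/-- The integer rounded Gram certificate of `c·(L − μ·1)` (rows only; symmetry is free). -/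
theorem l6sG0_gram : IsGramCertZ l6sG0A l6sG0dg l6sG0R := by
  refine isGramCertZ_of_rows l6sG0A l6sG0dg l6sG0R l6sG0_Asym fun i => ?_

  by_cases c0 : (i : ℕ) < 23
  · exact l6sG0_grows0 i (Nat.zero_le _) c0
  by_cases c1 : (i : ℕ) < 47
  · exact l6sG0_grows1 i (by omega) c1
  · exact l6sG0_grows2 i (by omega) (by omega)

/-! ## §3 The block theorem -/

/-- **THE `G_0` BLOCK OF THE L = 6 DQG+S² LIFT IS PSD ALONG THE FAMILY**: `X(ε) ⪰ 0` for `0 < ε ≤ 1` with `ε·(ρ₁ + ρ₂) ≤ μ`. -/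
theorem l6sG0_psd {ε : ℝ} (hε0 : 0 < ε) (hε1 : ε ≤ 1) (hεμ : ε * ((l6sG0rho1 + l6sG0rho2 : ℚ) : ℝ) ≤ (l6sG0mu : ℝ)) :
    (realXQ l6sG0X ε).PosSemidef := by
  have hc : (0 : ℚ) < l6sG0c := by norm_num [l6sG0c]
  exact realXQ_posSemidef l6sG0X l6sG0fr l6sG0W l6sG0pi l6sG0mu l6sG0rho1 l6sG0rho2 l6sG0A l6sG0dg l6sG0R l6sG0c l6sG0_hW l6sG0_h0 l6sG0_h1 l6sG0_sym.1 l6sG0_sym.2.1 l6sG0_sym.2.2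
    l6sG0_gram hc l6sG0_hA l6sG0_dead l6sG0_rho.1 l6sG0_rho.2 hε0 hε1 hεμ

end LiftL6

end Summit.Ventures.CertifiedQuantumChemistry
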